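import Summits.AtomisticToContinuum.Crystallization.Theorems.FrustratedLawDichotomyTransportPriceFiniteForce

/-!
# FrustratedLawDichotomy · cruxes `AperiodicFrustratedLawGap` (27623) AND `PeriodicFrustratedLawGap` (27624) — ONE FINITE INEQUALITY CLOSES THE WHOLE FRUSTRATED-LAW GAP
# (decomp-a2c, prover hand 2, structural share, generation 3)

The transport argument never used aperiodicity: the force-loaded FINITE-CLUSTER PRICE (R5, `…TransportPriceFiniteForce`) has no periodicity
clause, so it bounds EVERY texture-charging Nash point-stationary hard-core law, periodic charge or not.  This file re-runs the chain without the
`P(PerSet) = 0` hypothesis: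

* `truncatedSurplusPrice₀_of_forceFiniteClusterPrice`, `realSurplusPrice₀_of_truncatedSurplusPrice₀` — the periodicity-free links;
* `frustratedLawGap_of_realSurplusPrice₀` — the PERIODICITY-FREE GAP: clauses (a)(b)(d)(e) alone give `e⋆ < E_P[rootEnergy]`;
* `frustratedLawGap_of_forceFiniteClusterPrice` — R5 ⟹ the periodicity-free gap;
* `periodicFrustratedLawGap_of_forceFiniteClusterPrice` — hence the SIBLING CRUX `PeriodicFrustratedLawGap` (item 27624, the attacked
  piece) BY NAME; with `…TransportPriceFiniteForce.aperiodicFrustratedLawGap_of_forceFiniteClusterPrice` (the residual) this means: ONE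
  finite semi-algebraic inequality over textured, near-neighboured, locally stable, force-balanced finite clusters closes BOTH law cruxes.

All `[folklore]`.
-/

noncomputable section

namespace Summit.AtomisticToContinuum.Crystallization.Theorems.FrustratedLawDichotomyTransportPriceFrustratedGap

open MeasureTheory Metric Set Filter
open scoped ENNReal Topology BigOperators
open Literature.MathematicalPhysics.StatisticalMechanics Literature.Probability.Process
open Summit.AtomisticToContinuum.Crystallization.Theorems.ChargedEnergyGapNegative (E3 eStar)
open Summit.AtomisticToContinuum.Crystallization.Theorems.FrustratedLawDichotomyFiniteClusterGap (ae_mem_of_sep)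
open Summit.AtomisticToContinuum.Crystallization.Theorems.FrustratedLawDichotomyTransportPriceReal (surplus_toReal_sub_eq_integral)
open Summit.AtomisticToContinuum.Crystallization.Theorems.FrustratedLawDichotomyTransportPriceEquilibrium
  (eStar_lt_integral_rootEnergy_of_ae_surplusSharing)
open Summit.AtomisticToContinuum.Crystallization.Theorems.FrustratedLawDichotomyTransportPriceTail (abs_rootEnergy_sub_truncated_le)
open Summit.AtomisticToContinuum.Crystallization.Theorems.FrustratedLawDichotomyTransportPriceTruncated (truncatedSurplus_le_surplus)
open Summit.AtomisticToContinuum.Crystallization.Theorems.FrustratedLawDichotomyTransportPriceFinite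
  (preimage_sub_closedBall map_sub_apply_closedBall count_restrict_closedBall_eq_card setIntegral_map_sub_eq_sum)
open Summit.AtomisticToContinuum.Crystallization.Theorems.FrustratedLawDichotomyTransportPriceFiniteEq (truncated_laplacian_nonneg)
open Summit.AtomisticToContinuum.Crystallization.Theorems.FrustratedLawDichotomyTransportPriceFiniteForce (truncated_force_le)
open Summit.AtomisticToContinuum.Crystallization.Theorems.FrustratedLawDichotomyHardCoreUpgrade (ae_isRootedHardCore_upgrade)
open Summit.AtomisticToContinuum.Crystallization.Theorems.FrustratedLawDichotomyAperiodicGapFiniteCut (ae_infinite_of_minimising_of_decl)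
open Summit.AtomisticToContinuum.Crystallization.Theorems.FrustratedLawDichotomyNashForceBalance (ae_forceBalance_of_nash)
open Summit.AtomisticToContinuum.Crystallization.Theorems.FrustratedLawDichotomyNashLocalStability
  (ae_laplacian_nonneg_of_nash ae_exists_near_of_nash)
open Literature.Probability.Process.LocalConfig (finite_inter_of_separated)

/-- **R5 ⟹ truncated surplus price, periodicity-free.** [folklore] -/
theorem truncatedSurplusPrice₀_of_forceFiniteClusterPrice
    (h : ∀ δ : ℝ, 0 < δ → ∀ R₇ R₈ R₉ : ℝ, let Gy : ℝ → (N : ℕ) → (Fin N → EuclideanSpace ℝ (Fin 3)) → Fin N → Prop := fun η N y j => let d : ℝ := sInf ((fun z => dist z (y (j : Fin N))) '' (Set.range (y) \ {(y (j : Fin N))})); let T : Set (EuclideanSpace ℝ (Fin 3)) := {z : EuclideanSpace ℝ (Fin 3) | z ∈ Set.range (y) ∧ z ≠ (y (j : Fin N)) ∧ dist z (y (j : Fin N)) < 13 / 10 * d}; ∃ A : EuclideanSpace ℝ (Fin 3) →ₗᵢ[ℝ] EuclideanSpace ℝ (Fin 3), (∃ e : ↥T ≃ ↥Literature.Geometry.DiscreteGeometry.fccKissingPattern,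 ∀ t : ↥T, dist (d⁻¹ • ((t : EuclideanSpace ℝ (Fin 3)) - (y (j : Fin N)))) (A ((e t : ↥Literature.Geometry.DiscreteGeometry.fccKissingPattern) : EuclideanSpace ℝ (Fin 3))) ≤ η) ∨ (∃ e : ↥T ≃ ↥Literature.Geometry.DiscreteGeometry.hcpKissingPattern, ∀ t : ↥T, dist (d⁻¹ • ((t : EuclideanSpace ℝ (Fin 3)) - (y (j : Fin N)))) (A ((e t : ↥Literature.Geometry.DiscreteGeometry.hcpKissingPattern) : EuclideanSpace ℝ (Fin 3))) ≤ η); let TexBall : (N : ℕ) → (Fin N → EuclideanSpace ℝ (Fin 3)) → Fin N → ℝ → ℝ → ℝ → ℝ → Prop := fun N y i R R₇ R₈ R₉ => (∀ a b : Fin N, a ≠ b → (7 : ℝ) / 10 ≤ dist (y a) (y b)) ∧ (∀ j : Fin N, dist (y j) (y i) ≤ R → ¬ Gy (1 / 20) N (y) j) ∧ (∀ j : Fin N, dist (y j) (y i) ≤ R → ¬ ((∀ j' : Fin N, dist (y j') (y j) ≤ R₇ → ¬ Gy (1 / 20) N (y) j') ∧ (∀ z : EuclideanSpace ℝ (Fin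 3), dist z (y j) ≤ R₇ → ∃ k : Fin N, dist z (y k) ≤ 1) ∧ (∀ j' : Fin N, dist (y j') (y j) ≤ R₇ → (let d : ℝ := sInf ((fun z => dist z (y j')) '' (Set.range (y) \ {(y j')})); ∀ k : Fin N, y k ≠ y j' → dist (y k) (y j') < 27 / 20 * d → 5 ≤ Nat.card {m : Fin N // y m ≠ y j' ∧ dist (y m) (y j') < 27 / 20 * d ∧ y m ≠ y k ∧ dist (y m) (y k) < 27 / 20 * d})))) ∧ (∀ j : Fin N, dist (y j) (y i) ≤ R → ∃ k : Fin N, dist (y k) (y j) ≤ R₈ ∧ Gy (1 / 8) N (y) k) ∧ (∀ j : Fin N, dist (y j) (y i) ≤ R → ¬ ((∀ j' : Fin N, dist (y j') (y j) ≤ R₉ → ¬ Gy (1 / 20) N (y) j') ∧ (Nat.card {j' : Fin N // dist (y j') (y j) ≤ R₉ ∧ ¬ Gy (1 / 8) N (y) j'} : ℝ) ≤ 1 / 2 * (Nat.card {j' : Fin N // dist (y j') (y j) ≤ R₉} : ℝ) ∧ (∀ j' : Fin N, dist (y j') (y j) ≤ R₉ → ¬ Gy (1 / 8) N (y) j' →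 ¬ (let d : ℝ := sInf ((fun z => dist z (y j')) '' (Set.range (y) \ {(y j')})); ∀ k : Fin N, y k ≠ y j' → dist (y k) (y j') < 27 / 20 * d → 5 ≤ Nat.card {m : Fin N // y m ≠ y j' ∧ dist (y m) (y j') < 27 / 20 * d ∧ y m ≠ y k ∧ dist (y m) (y k) < 27 / 20 * d})))); ∃ r : ℝ, 0 < r ∧ ∃ Rc : ℝ, 6 / 5 ≤ Rc ∧ ∀ ω : Finset (EuclideanSpace ℝ (Fin 3)), (0 : EuclideanSpace ℝ (Fin 3)) ∈ ω → (∀ p ∈ ω, ‖p‖ ≤ 2 * r + Rc + 1) → (∀ a ∈ ω, ∀ b ∈ ω, a ≠ b → δ ≤ dist a b) → (∀ a ∈ ω, ∀ b ∈ ω, a ≠ b → (7 : ℝ) / 10 ≤ dist a b) → (∀ q ∈ ω, ‖q‖ ≤ r → ∀ ε : ℝ, 0 < ε → ε ≤ 1 → ∃ (N : ℕ) (y : Fin N → EuclideanSpace ℝ (Fin 3)) (i : Fin N), TexBall N y i (r + Rc) R₇ R₈ R₉ ∧ (∀ p ∈ ω, dist p q ≤ r + Rc → ∃ k : Fin N,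 dist (y k - y i) (p - q) ≤ ε) ∧ (∀ k : Fin N, dist (y k) (y i) ≤ r + Rc → ∃ p ∈ ω, dist (y k - y i) (p - q) ≤ ε)) → (∀ p ∈ ω, ‖p‖ ≤ r → ∃ q ∈ ω, q ≠ p ∧ dist p q ^ 6 ≤ 11 / 5) → (∀ p ∈ ω, ‖p‖ ≤ r → 0 ≤ ∑ q ∈ ω.filter (fun q : EuclideanSpace ℝ (Fin 3) => q ≠ p ∧ ‖q - p‖ ≤ Rc), (11 * (dist p q)⁻¹ ^ 14 - 5 * (dist p q)⁻¹ ^ 8)) → (∀ p ∈ ω, ‖p‖ ≤ r → ‖∑ q ∈ ω.filter (fun q : EuclideanSpace ℝ (Fin 3) => q ≠ p ∧ ‖q - p‖ ≤ Rc), (((dist p q)⁻¹ ^ 8 - (dist p q)⁻¹ ^ 14) • (p - q))‖ ≤ (Rc⁻¹ ^ 7 + Rc⁻¹) * (250 * (7 / 10 : ℝ)⁻¹ ^ 3 * Rc⁻¹ ^ 3)) → 0 < (∑ y ∈ ω.filter (fun y : EuclideanSpace ℝ (Fin 3) => ‖y‖ ≤ r), ((∑ q ∈ ω.filter (fun q :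 EuclideanSpace ℝ (Fin 3) => ‖q - y‖ ≤ Rc), Literature.MathematicalPhysics.StatisticalMechanics.lennardJones ‖q - y‖) / 2 - ((7 / 10 : ℝ)⁻¹ ^ 6 / 12 + 1 / 6) * (250 * (7 / 10 : ℝ)⁻¹ ^ 3 * Rc⁻¹ ^ 3) / 2 - (⨅ Q : Literature.MathematicalPhysics.StatisticalMechanics.PeriodicConfiguration 3, Q.energyPerParticle Literature.MathematicalPhysics.StatisticalMechanics.lennardJones)) / ((ω.filter (fun q : EuclideanSpace ℝ (Fin 3) => ‖q - y‖ ≤ r)).card : ℝ))) :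
    ∀ δ : ℝ, 0 < δ → ∀ R₇ R₈ R₉ : ℝ, let Gy : ℝ → (N : ℕ) → (Fin N → EuclideanSpace ℝ (Fin 3)) → Fin N → Prop := fun η N y j => let d : ℝ := sInf ((fun z => dist z (y (j : Fin N))) '' (Set.range (y) \ {(y (j : Fin N))})); let T : Set (EuclideanSpace ℝ (Fin 3)) := {z : EuclideanSpace ℝ (Fin 3) | z ∈ Set.range (y) ∧ z ≠ (y (j : Fin N)) ∧ dist z (y (j : Fin N)) < 13 / 10 * d}; ∃ A : EuclideanSpace ℝ (Fin 3) →ₗᵢ[ℝ] EuclideanSpace ℝ (Fin 3), (∃ e : ↥T ≃ ↥Literature.Geometry.DiscreteGeometry.fccKissingPattern, ∀ t : ↥T, dist (d⁻¹ • ((t : EuclideanSpace ℝ (Fin 3)) - (y (j : Fin N)))) (A ((e t : ↥Literature.Geometry.DiscreteGeometry.fccKissingPattern) : EuclideanSpace ℝ (Fin 3))) ≤ η) ∨ (∃ e : ↥T ≃ ↥Literature.Geometry.DiscreteGeometry.hcpKissingPattern, ∀ t : ↥T, dist (d⁻¹ • ((t : EuclideanSpace ℝ (Fin 3)) - (y (j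 : Fin N)))) (A ((e t : ↥Literature.Geometry.DiscreteGeometry.hcpKissingPattern) : EuclideanSpace ℝ (Fin 3))) ≤ η); let TexBall : (N : ℕ) → (Fin N → EuclideanSpace ℝ (Fin 3)) → Fin N → ℝ → ℝ → ℝ → ℝ → Prop := fun N y i R R₇ R₈ R₉ => (∀ a b : Fin N, a ≠ b → (7 : ℝ) / 10 ≤ dist (y a) (y b)) ∧ (∀ j : Fin N, dist (y j) (y i) ≤ R → ¬ Gy (1 / 20) N (y) j) ∧ (∀ j : Fin N, dist (y j) (y i) ≤ R → ¬ ((∀ j' : Fin N, dist (y j') (y j) ≤ R₇ → ¬ Gy (1 / 20) N (y) j') ∧ (∀ z : EuclideanSpace ℝ (Fin 3), dist z (y j) ≤ R₇ → ∃ k : Fin N, dist z (y k) ≤ 1) ∧ (∀ j' : Fin N, dist (y j') (y j) ≤ R₇ → (let d : ℝ := sInf ((fun z => dist z (y j')) '' (Set.range (y) \ {(y j')})); ∀ k : Fin N, y k ≠ y j' → dist (y k) (y j') < 27 / 20 * d → 5 ≤ Nat.card {m : Fin N // y m ≠ y j' ∧ dist (y m) (y j') < 27 / 20 * d ∧ y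 m ≠ y k ∧ dist (y m) (y k) < 27 / 20 * d})))) ∧ (∀ j : Fin N, dist (y j) (y i) ≤ R → ∃ k : Fin N, dist (y k) (y j) ≤ R₈ ∧ Gy (1 / 8) N (y) k) ∧ (∀ j : Fin N, dist (y j) (y i) ≤ R → ¬ ((∀ j' : Fin N, dist (y j') (y j) ≤ R₉ → ¬ Gy (1 / 20) N (y) j') ∧ (Nat.card {j' : Fin N // dist (y j') (y j) ≤ R₉ ∧ ¬ Gy (1 / 8) N (y) j'} : ℝ) ≤ 1 / 2 * (Nat.card {j' : Fin N // dist (y j') (y j) ≤ R₉} : ℝ) ∧ (∀ j' : Fin N, dist (y j') (y j) ≤ R₉ → ¬ Gy (1 / 8) N (y) j' → ¬ (let d : ℝ := sInf ((fun z => dist z (y j')) '' (Set.range (y) \ {(y j')})); ∀ k : Fin N, y k ≠ y j' → dist (y k) (y j') < 27 / 20 * d → 5 ≤ Nat.card {m : Fin N // y m ≠ y j' ∧ dist (y m) (y j') < 27 / 20 * d ∧ y m ≠ y k ∧ dist (y m) (y k) < 27 / 20 * d})))); let Appr : MeasureTheory.Measure (EuclideanSpace ℝ (Fin 3)) → ℝ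 → ℝ → ℝ → Prop := fun μ R₇ R₈ R₉ => ∀ q : EuclideanSpace ℝ (Fin 3), μ {q} ≠ 0 → ∀ R ε : ℝ, 0 < ε → ∃ (N : ℕ) (y : Fin N → EuclideanSpace ℝ (Fin 3)) (i : Fin N), TexBall N y i R R₇ R₈ R₉ ∧ (∀ p : EuclideanSpace ℝ (Fin 3), μ {p} ≠ 0 → dist p q ≤ R → ∃ k : Fin N, dist (y k - y i) (p - q) ≤ ε) ∧ (∀ k : Fin N, dist (y k) (y i) ≤ R → ∃ p : EuclideanSpace ℝ (Fin 3), μ {p} ≠ 0 ∧ dist (y k - y i) (p - q) ≤ ε); ∃ r : ℝ, 0 < r ∧ ∃ Rc : ℝ, 7 / 10 ≤ Rc ∧ (∀ μ : MeasureTheory.Measure (EuclideanSpace ℝ (Fin 3)), Literature.Probability.Process.IsRootedHardCore δ μ → Literature.Probability.Process.IsRootedHardCore (7 / 10) μ → Appr μ R₇ R₈ R₉ → (∀ p : EuclideanSpace ℝ (Fin 3), μ {p} ≠ 0 → ∀ y : EuclideanSpace ℝ (Fin 3), (∀ q : EuclideanSpace ℝ (Fin 3), μ {q} ≠ 0 →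 q ≠ p → y ≠ q) → ∑' q : {q : EuclideanSpace ℝ (Fin 3) // μ {q} ≠ 0 ∧ q ≠ p}, Literature.MathematicalPhysics.StatisticalMechanics.lennardJones (dist p (q : EuclideanSpace ℝ (Fin 3))) ≤ ∑' q : {q : EuclideanSpace ℝ (Fin 3) // μ {q} ≠ 0 ∧ q ≠ p}, Literature.MathematicalPhysics.StatisticalMechanics.lennardJones (dist y (q : EuclideanSpace ℝ (Fin 3)))) → (∀ p : EuclideanSpace ℝ (Fin 3), μ {p} ≠ 0 → HasSum (fun q : {q : EuclideanSpace ℝ (Fin 3) // μ {q} ≠ 0 ∧ q ≠ p} => ((dist p (q : EuclideanSpace ℝ (Fin 3)))⁻¹ ^ 8 - (dist p (q : EuclideanSpace ℝ (Fin 3)))⁻¹ ^ 14) • (p - (q : EuclideanSpace ℝ (Fin 3)))) 0 ∧ (∃ L : ℝ, 0 ≤ L ∧ HasSum (fun q : {q : EuclideanSpace ℝ (Fin 3) // μ {q} ≠ 0 ∧ q ≠ p} => 11 * (dist p (q : EuclideanSpace ℝ (Fin 3)))⁻¹ ^ 14 - 5 * (dist p (q : EuclideanSpace ℝ (Fin 3)))⁻¹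 ^ 8) L) ∧ ((∃ q : EuclideanSpace ℝ (Fin 3), μ {q} ≠ 0 ∧ q ≠ p) → ∃ q : EuclideanSpace ℝ (Fin 3), μ {q} ≠ 0 ∧ q ≠ p ∧ dist p q ^ 6 ≤ 11 / 5)) → {p : EuclideanSpace ℝ (Fin 3) | μ {p} ≠ 0}.Infinite → 0 < (∫ y in Metric.closedBall (0 : EuclideanSpace ℝ (Fin 3)) r, ((∫ z in Metric.closedBall (0 : EuclideanSpace ℝ (Fin 3)) Rc, Literature.MathematicalPhysics.StatisticalMechanics.lennardJones ‖z‖ ∂(MeasureTheory.Measure.map (fun z : EuclideanSpace ℝ (Fin 3) => z - y) μ)) / 2 - ((7 / 10 : ℝ)⁻¹ ^ 6 / 12 + 1 / 6) * (250 * (7 / 10 : ℝ)⁻¹ ^ 3 * Rc⁻¹ ^ 3) / 2 - (⨅ Q : Literature.MathematicalPhysics.StatisticalMechanics.PeriodicConfiguration 3, Q.energyPerParticle Literature.MathematicalPhysics.StatisticalMechanics.lennardJones)) / ((MeasureTheory.Measure.map (fun z : EuclideanSpace ℝ (Fin 3) => z - y) μ) (Metric.closedBall (0 : EuclideanSpace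 ℝ (Fin 3)) r)).toReal ∂μ)) := by
  classical
  intro δ hδ R₇ R₈ R₉
  have h' := h δ hδ R₇ R₈ R₉
  dsimp only at h' ⊢
  obtain ⟨r, hr, Rc, hRc, hF⟩ := h'
  refine ⟨r, hr, Rc, by linarith, fun μ hμδ hμ7 hd he hE hinf => ?_⟩
  obtain ⟨S, h0S, hsep, hμS⟩ := id hμ7
  have h7 : (0 : ℝ) < 7 / 10 := by norm_num
  have hsepδ : ∀ a ∈ S, ∀ b ∈ S, a ≠ b → δ ≤ dist a b := by
    obtain ⟨S', -, hsep', hμS'⟩ := hμδ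
    intro a ha b hb hab
    have ha' : a ∈ S' := (count_restrict_singleton_ne_zero_iff S' a).mp (by rw [← hμS', hμS]; exact (count_restrict_singleton_ne_zero_iff S a).mpr ha)
    have hb' : b ∈ S' := (count_restrict_singleton_ne_zero_iff S' b).mp (by rw [← hμS', hμS]; exact (count_restrict_singleton_ne_zero_iff S b).mpr hb)
    exact hsep' a ha' b hb' hab
  set ρ : ℝ := 2 * r + Rc + 1 with hρ
  have hrρ : r ≤ ρ := by rw [hρ]; linarith
  have hρ0 : 0 ≤ ρ := by rw [hρ]; linarith
  have hfinρ : (closedBall (0 : E3) ρ ∩ S).Finite := finite_inter_of_separated h7 hsep (isCompact_closedBall (0 : E3) ρ)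
  set ω : Finset E3 := hfinρ.toFinset with hω
  have hmemω : ∀ p : E3, p ∈ ω ↔ ‖p‖ ≤ ρ ∧ p ∈ S := fun p => by
    rw [hω, Finite.mem_toFinset, mem_inter_iff, mem_closedBall, dist_zero_right]
  have h0ω : (0 : E3) ∈ ω := (hmemω 0).mpr ⟨by rw [norm_zero]; exact hρ0, h0S⟩
  have hballω : ∀ p ∈ ω, ‖p‖ ≤ 2 * r + Rc + 1 := fun p hp => by have := ((hmemω p).mp hp).1; rw [hρ] at this; exact this
  have hsepω : ∀ a ∈ ω, ∀ b ∈ ω, a ≠ b → δ ≤ dist a b := fun a ha b hb hab =>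
    hsepδ a ((hmemω a).mp ha).2 b ((hmemω b).mp hb).2 hab
  have hsep7ω : ∀ a ∈ ω, ∀ b ∈ ω, a ≠ b → (7 : ℝ) / 10 ≤ dist a b := fun a ha b hb hab =>
    hsep a ((hmemω a).mp ha).2 b ((hmemω b).mp hb).2 hab
  have hball_sub : ∀ y : E3, ‖y‖ ≤ r → ∀ R : ℝ, R ≤ r + Rc → ∀ q : E3, ‖q - y‖ ≤ R → ‖q‖ ≤ ρ := by
    intro y hy R hR q hq
    calc ‖q‖ = ‖(q - y) + y‖ := by rw [sub_add_cancel]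
      _ ≤ ‖q - y‖ + ‖y‖ := norm_add_le _ _
      _ ≤ ρ := by rw [hρ]; linarith
  have hatom : ∀ p ∈ ω, μ {p} ≠ 0 := fun p hp => by
    rw [hμS]; exact (count_restrict_singleton_ne_zero_iff S p).mpr ((hmemω p).mp hp).2
  -- the finite inequality, with texture / near neighbour / truncated Laplacian stability supplied from the configuration
  have hpos := hF ω h0ω hballω hsepω hsep7ω (fun q hq hqr ε hε hε1 => by
      obtain ⟨N, y, i, hT, hm1, hm2⟩ := hd q (hatom q hq) (r + Rc) ε hε
      refine ⟨N, y, i, hT, fun p hp hpq => hm1 p (hatom p hp) hpq, fun k hk => ?_⟩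
      obtain ⟨p, hp0, hpk⟩ := hm2 k hk
      have hpS : p ∈ S := by rw [hμS] at hp0; exact (count_restrict_singleton_ne_zero_iff S p).mp hp0
      refine ⟨p, (hmemω p).mpr ⟨?_, hpS⟩, hpk⟩
      have h1 : ‖p - q‖ ≤ ‖y k - y i‖ + ε := by
        have hdk : ‖p - q - (y k - y i)‖ ≤ ε := by
          rw [← dist_eq_norm, dist_comm]; exact hpk
        calc ‖p - q‖ = ‖(p - q - (y k - y i)) + (y k - y i)‖ := by rw [sub_add_cancel]
          _ ≤ ‖p - q - (y k - y i)‖ + ‖y k - y i‖ := norm_add_le _ _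
          _ ≤ ‖y k - y i‖ + ε := by linarith
      have h2 : ‖y k - y i‖ ≤ r + Rc := by rw [← dist_eq_norm]; exact hk
      calc ‖p‖ = ‖(p - q) + q‖ := by rw [sub_add_cancel]
        _ ≤ ‖p - q‖ + ‖q‖ := norm_add_le _ _
        _ ≤ ρ := by rw [hρ]; linarith)
    (fun p hp hpr => by
      -- near neighbour within (11/5)^(1/6) < 6/5, hence inside the cluster
      obtain ⟨-, -, hnear⟩ := hE p (hatom p hp)
      obtain ⟨q', hq'mem, hq'p⟩ := hinf.exists_notMem_finset {p}
      have hq'ne : q' ≠ p := fun h => hq'p (by rw [h]; exact Finset.mem_singleton_self p)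
      obtain ⟨q, hq0, hqp, hqd⟩ := hnear ⟨q', hq'mem, hq'ne⟩
      have hqS : q ∈ S := by rw [hμS] at hq0; exact (count_restrict_singleton_ne_zero_iff S q).mp hq0
      have hdist : dist p q ≤ 6 / 5 := by
        by_contra hlt
        have hgt : 6 / 5 < dist p q := not_le.mp hlt
        have : (6 / 5 : ℝ) ^ 6 < dist p q ^ 6 := by gcongr
        norm_num at this
        linarith
      refine ⟨q, (hmemω q).mpr ⟨?_, hqS⟩, hqp, hqd⟩
      have : ‖q - p‖ ≤ 6 / 5 := by rw [← dist_eq_norm, dist_comm]; exact hdist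
      calc ‖q‖ = ‖(q - p) + p‖ := by rw [sub_add_cancel]
        _ ≤ ‖q - p‖ + ‖p‖ := norm_add_le _ _
        _ ≤ ρ := by rw [hρ]; linarith)
    (fun p hp hpr => by
      obtain ⟨-, ⟨L, hL0, hsum⟩, -⟩ := hE p (hatom p hp)
      rw [hμS] at hsum
      refine truncated_laplacian_nonneg hsep p hRc hL0 hsum _ fun q => ?_
      rw [Finset.mem_filter, hmemω]
      constructor
      · rintro ⟨⟨-, hqS⟩, hqp, hq⟩; exact ⟨⟨hqS, hqp⟩, hq⟩
      · rintro ⟨⟨hqS, hqp⟩, hq⟩; exact ⟨⟨hball_sub p hpr Rc (by linarith) q hq, hqS⟩, hqp, hq⟩)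
    (fun p hp hpr => by
      obtain ⟨hforce, -, -⟩ := hE p (hatom p hp)
      rw [hμS] at hforce
      refine truncated_force_le hsep ((hmemω p).mp hp).2 (by linarith) hforce _ fun q => ?_
      rw [Finset.mem_filter, hmemω]
      constructor
      · rintro ⟨⟨-, hqS⟩, hqp, hq⟩; exact ⟨⟨hqS, hqp⟩, hq⟩
      · rintro ⟨⟨hqS, hqp⟩, hq⟩; exact ⟨⟨hball_sub p hpr Rc (by linarith) q hq, hqS⟩, hqp, hq⟩)
  -- the truncated integral IS the finite sum
  have hfinr : (closedBall (0 : E3) r ∩ S).Finite := finite_inter_of_separated h7 hsep (isCompact_closedBall (0 : E3) r)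
  have hωr : hfinr.toFinset = ω.filter (fun y : E3 => ‖y‖ ≤ r) := by
    ext y
    rw [Finite.mem_toFinset, Finset.mem_filter, hmemω, mem_inter_iff, mem_closedBall, dist_zero_right]
    constructor
    · rintro ⟨hy, hyS⟩; exact ⟨⟨hy.trans hrρ, hyS⟩, hy⟩
    · rintro ⟨⟨-, hyS⟩, hy⟩; exact ⟨hy, hyS⟩
  have hfilt : ∀ y : E3, ‖y‖ ≤ r → ∀ R : ℝ, R ≤ r + Rc → ∀ hfin : (closedBall y R ∩ S).Finite,
      hfin.toFinset = ω.filter (fun q : E3 => ‖q - y‖ ≤ R) := by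
    intro y hy R hR hfin
    ext q
    rw [Finite.mem_toFinset, Finset.mem_filter, hmemω, mem_inter_iff, mem_closedBall, dist_eq_norm]
    constructor
    · rintro ⟨hq, hqS⟩; exact ⟨⟨hball_sub y hy R hR q hq, hqS⟩, hq⟩
    · rintro ⟨⟨-, hqS⟩, hq⟩; exact ⟨hq, hqS⟩
  have heq : (∫ y in closedBall (0 : E3) r, ((∫ z in closedBall (0 : E3) Rc, lennardJones ‖z‖ ∂(μ.map fun z : E3 => z - y)) / 2 -
        ((7 / 10 : ℝ)⁻¹ ^ 6 / 12 + 1 / 6) * (250 * (7 / 10 : ℝ)⁻¹ ^ 3 * Rc⁻¹ ^ 3) / 2 -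
        (⨅ Q : PeriodicConfiguration 3, Q.energyPerParticle lennardJones)) /
        ((μ.map fun z : E3 => z - y) (closedBall (0 : E3) r)).toReal ∂μ) =
      ∑ y ∈ ω.filter (fun y : E3 => ‖y‖ ≤ r),
        ((∑ q ∈ ω.filter (fun q : E3 => ‖q - y‖ ≤ Rc), lennardJones ‖q - y‖) / 2 -
          ((7 / 10 : ℝ)⁻¹ ^ 6 / 12 + 1 / 6) * (250 * (7 / 10 : ℝ)⁻¹ ^ 3 * Rc⁻¹ ^ 3) / 2 -
          (⨅ Q : PeriodicConfiguration 3, Q.energyPerParticle lennardJones)) /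
        ((ω.filter (fun q : E3 => ‖q - y‖ ≤ r)).card : ℝ) := by
    rw [hμS, Measure.restrict_restrict measurableSet_closedBall]
    have hcoe : (Measure.count : Measure E3).restrict (closedBall (0 : E3) r ∩ S) =
        (Measure.count : Measure E3).restrict (↑hfinr.toFinset : Set E3) := by rw [Finite.coe_toFinset]
    rw [hcoe, integral_count_restrict_coe_finset, hωr]
    refine Finset.sum_congr rfl fun y hy => ?_
    have hyr : ‖y‖ ≤ r := (Finset.mem_filter.mp hy).2
    have hfinRc : (closedBall y Rc ∩ S).Finite := finite_inter_of_separated h7 hsep (isCompact_closedBall y Rc)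
    have hfinyr : (closedBall y r ∩ S).Finite := finite_inter_of_separated h7 hsep (isCompact_closedBall y r)
    rw [setIntegral_map_sub_eq_sum y Rc hfinRc, hfilt y hyr Rc (by linarith) hfinRc, map_sub_apply_closedBall,
      count_restrict_closedBall_eq_card y r hfinyr, hfilt y hyr r (by linarith) hfinyr, ENNReal.toReal_natCast]
  rw [heq]
  exact hpos


/-- **Truncated ⟹ real surplus price, periodicity-free.** [folklore] -/
theorem realSurplusPrice₀_of_truncatedSurplusPrice₀
    (h : ∀ δ : ℝ, 0 < δ → ∀ R₇ R₈ R₉ : ℝ, let Gy : ℝ → (N : ℕ) → (Fin N → EuclideanSpace ℝ (Fin 3)) → Fin N → Prop := fun η N y j => let d : ℝ := sInf ((fun z => dist z (y (j : Fin N))) '' (Set.range (y) \ {(y (j : Fin N))})); let T : Set (EuclideanSpace ℝ (Fin 3)) := {z : EuclideanSpace ℝ (Fin 3) | z ∈ Set.range (y) ∧ z ≠ (y (j : Fin N)) ∧ dist z (y (j : Fin N)) < 13 / 10 * d}; ∃ A : EuclideanSpace ℝ (Fin 3) →ₗᵢ[ℝ] EuclideanSpace ℝ (Fin 3), (∃ e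 : ↥T ≃ ↥Literature.Geometry.DiscreteGeometry.fccKissingPattern, ∀ t : ↥T, dist (d⁻¹ • ((t : EuclideanSpace ℝ (Fin 3)) - (y (j : Fin N)))) (A ((e t : ↥Literature.Geometry.DiscreteGeometry.fccKissingPattern) : EuclideanSpace ℝ (Fin 3))) ≤ η) ∨ (∃ e : ↥T ≃ ↥Literature.Geometry.DiscreteGeometry.hcpKissingPattern, ∀ t : ↥T, dist (d⁻¹ • ((t : EuclideanSpace ℝ (Fin 3)) - (y (j : Fin N)))) (A ((e t : ↥Literature.Geometry.DiscreteGeometry.hcpKissingPattern) : EuclideanSpace ℝ (Fin 3))) ≤ η); let TexBall : (N : ℕ) → (Fin N → EuclideanSpace ℝ (Fin 3)) → Fin N → ℝ → ℝ → ℝ → ℝ → Prop := fun N y i R R₇ R₈ R₉ => (∀ a b : Fin N, a ≠ b → (7 : ℝ) / 10 ≤ dist (y a) (y b)) ∧ (∀ j : Fin N, dist (y j) (y i) ≤ R → ¬ Gy (1 / 20) N (y) j) ∧ (∀ j : Fin N, dist (y j) (y i) ≤ R → ¬ ((∀ j' : Fin N, dist (y j') (y j) ≤ R₇ → ¬ Gy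 (1 / 20) N (y) j') ∧ (∀ z : EuclideanSpace ℝ (Fin 3), dist z (y j) ≤ R₇ → ∃ k : Fin N, dist z (y k) ≤ 1) ∧ (∀ j' : Fin N, dist (y j') (y j) ≤ R₇ → (let d : ℝ := sInf ((fun z => dist z (y j')) '' (Set.range (y) \ {(y j')})); ∀ k : Fin N, y k ≠ y j' → dist (y k) (y j') < 27 / 20 * d → 5 ≤ Nat.card {m : Fin N // y m ≠ y j' ∧ dist (y m) (y j') < 27 / 20 * d ∧ y m ≠ y k ∧ dist (y m) (y k) < 27 / 20 * d})))) ∧ (∀ j : Fin N, dist (y j) (y i) ≤ R → ∃ k : Fin N, dist (y k) (y j) ≤ R₈ ∧ Gy (1 / 8) N (y) k) ∧ (∀ j : Fin N, dist (y j) (y i) ≤ R → ¬ ((∀ j' : Fin N, dist (y j') (y j) ≤ R₉ → ¬ Gy (1 / 20) N (y) j') ∧ (Nat.card {j' : Fin N // dist (y j') (y j) ≤ R₉ ∧ ¬ Gy (1 / 8) N (y) j'} : ℝ) ≤ 1 / 2 * (Nat.card {j' : Fin N // dist (y j') (y j) ≤ R₉} : ℝ) ∧ (∀ j' : Fin N,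 dist (y j') (y j) ≤ R₉ → ¬ Gy (1 / 8) N (y) j' → ¬ (let d : ℝ := sInf ((fun z => dist z (y j')) '' (Set.range (y) \ {(y j')})); ∀ k : Fin N, y k ≠ y j' → dist (y k) (y j') < 27 / 20 * d → 5 ≤ Nat.card {m : Fin N // y m ≠ y j' ∧ dist (y m) (y j') < 27 / 20 * d ∧ y m ≠ y k ∧ dist (y m) (y k) < 27 / 20 * d})))); let Appr : MeasureTheory.Measure (EuclideanSpace ℝ (Fin 3)) → ℝ → ℝ → ℝ → Prop := fun μ R₇ R₈ R₉ => ∀ q : EuclideanSpace ℝ (Fin 3), μ {q} ≠ 0 → ∀ R ε : ℝ, 0 < ε → ∃ (N : ℕ) (y : Fin N → EuclideanSpace ℝ (Fin 3)) (i : Fin N), TexBall N y i R R₇ R₈ R₉ ∧ (∀ p : EuclideanSpace ℝ (Fin 3), μ {p} ≠ 0 → dist p q ≤ R → ∃ k : Fin N, dist (y k - y i) (p - q) ≤ ε) ∧ (∀ k : Fin N, dist (y k) (y i) ≤ R → ∃ p : EuclideanSpace ℝ (Fin 3), μ {p} ≠ 0 ∧ dist (y k - y i) (p - q) ≤ ε);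 ∃ r : ℝ, 0 < r ∧ ∃ Rc : ℝ, 7 / 10 ≤ Rc ∧ (∀ μ : MeasureTheory.Measure (EuclideanSpace ℝ (Fin 3)), Literature.Probability.Process.IsRootedHardCore δ μ → Literature.Probability.Process.IsRootedHardCore (7 / 10) μ → Appr μ R₇ R₈ R₉ → (∀ p : EuclideanSpace ℝ (Fin 3), μ {p} ≠ 0 → ∀ y : EuclideanSpace ℝ (Fin 3), (∀ q : EuclideanSpace ℝ (Fin 3), μ {q} ≠ 0 → q ≠ p → y ≠ q) → ∑' q : {q : EuclideanSpace ℝ (Fin 3) // μ {q} ≠ 0 ∧ q ≠ p}, Literature.MathematicalPhysics.StatisticalMechanics.lennardJones (dist p (q : EuclideanSpace ℝ (Fin 3))) ≤ ∑' q : {q : EuclideanSpace ℝ (Fin 3) // μ {q} ≠ 0 ∧ q ≠ p}, Literature.MathematicalPhysics.StatisticalMechanics.lennardJones (dist y (q : EuclideanSpace ℝ (Fin 3)))) → (∀ p : EuclideanSpace ℝ (Fin 3), μ {p} ≠ 0 → HasSum (fun q : {q : EuclideanSpace ℝ (Fin 3) // μ {q} ≠ 0 ∧ q ≠ p} => ((dist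 p (q : EuclideanSpace ℝ (Fin 3)))⁻¹ ^ 8 - (dist p (q : EuclideanSpace ℝ (Fin 3)))⁻¹ ^ 14) • (p - (q : EuclideanSpace ℝ (Fin 3)))) 0 ∧ (∃ L : ℝ, 0 ≤ L ∧ HasSum (fun q : {q : EuclideanSpace ℝ (Fin 3) // μ {q} ≠ 0 ∧ q ≠ p} => 11 * (dist p (q : EuclideanSpace ℝ (Fin 3)))⁻¹ ^ 14 - 5 * (dist p (q : EuclideanSpace ℝ (Fin 3)))⁻¹ ^ 8) L) ∧ ((∃ q : EuclideanSpace ℝ (Fin 3), μ {q} ≠ 0 ∧ q ≠ p) → ∃ q : EuclideanSpace ℝ (Fin 3), μ {q} ≠ 0 ∧ q ≠ p ∧ dist p q ^ 6 ≤ 11 / 5)) → {p : EuclideanSpace ℝ (Fin 3) | μ {p} ≠ 0}.Infinite → 0 < (∫ y in Metric.closedBall (0 : EuclideanSpace ℝ (Fin 3)) r, ((∫ z in Metric.closedBall (0 : EuclideanSpace ℝ (Fin 3)) Rc, Literature.MathematicalPhysics.StatisticalMechanics.lennardJones ‖z‖ ∂(MeasureTheory.Measure.map (fun z : EuclideanSpace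 ℝ (Fin 3) => z - y) μ)) / 2 - ((7 / 10 : ℝ)⁻¹ ^ 6 / 12 + 1 / 6) * (250 * (7 / 10 : ℝ)⁻¹ ^ 3 * Rc⁻¹ ^ 3) / 2 - (⨅ Q : Literature.MathematicalPhysics.StatisticalMechanics.PeriodicConfiguration 3, Q.energyPerParticle Literature.MathematicalPhysics.StatisticalMechanics.lennardJones)) / ((MeasureTheory.Measure.map (fun z : EuclideanSpace ℝ (Fin 3) => z - y) μ) (Metric.closedBall (0 : EuclideanSpace ℝ (Fin 3)) r)).toReal ∂μ))) :
    ∀ δ : ℝ, 0 < δ → ∀ R₇ R₈ R₉ : ℝ, let Gy : ℝ → (N : ℕ) → (Fin N → EuclideanSpace ℝ (Fin 3)) → Fin N → Prop := fun η N y j => let d : ℝ := sInf ((fun z => dist z (y (j : Fin N))) '' (Set.range (y) \ {(y (j : Fin N))})); let T : Set (EuclideanSpace ℝ (Fin 3)) := {z : EuclideanSpace ℝ (Fin 3) | z ∈ Set.range (y) ∧ z ≠ (y (j : Fin N)) ∧ dist z (y (j : Fin N)) < 13 / 10 * d}; ∃ A : EuclideanSpace ℝ (Fin 3) →ₗᵢ[ℝ]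 EuclideanSpace ℝ (Fin 3), (∃ e : ↥T ≃ ↥Literature.Geometry.DiscreteGeometry.fccKissingPattern, ∀ t : ↥T, dist (d⁻¹ • ((t : EuclideanSpace ℝ (Fin 3)) - (y (j : Fin N)))) (A ((e t : ↥Literature.Geometry.DiscreteGeometry.fccKissingPattern) : EuclideanSpace ℝ (Fin 3))) ≤ η) ∨ (∃ e : ↥T ≃ ↥Literature.Geometry.DiscreteGeometry.hcpKissingPattern, ∀ t : ↥T, dist (d⁻¹ • ((t : EuclideanSpace ℝ (Fin 3)) - (y (j : Fin N)))) (A ((e t : ↥Literature.Geometry.DiscreteGeometry.hcpKissingPattern) : EuclideanSpace ℝ (Fin 3))) ≤ η); let TexBall : (N : ℕ) → (Fin N → EuclideanSpace ℝ (Fin 3)) → Fin N → ℝ → ℝ → ℝ → ℝ → Prop := fun N y i R R₇ R₈ R₉ => (∀ a b : Fin N, a ≠ b → (7 : ℝ) / 10 ≤ dist (y a) (y b)) ∧ (∀ j : Fin N, dist (y j) (y i) ≤ R → ¬ Gy (1 / 20) N (y) j) ∧ (∀ j : Fin N, dist (y j) (y i) ≤ R → ¬ ((∀ j' : Fin N,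 dist (y j') (y j) ≤ R₇ → ¬ Gy (1 / 20) N (y) j') ∧ (∀ z : EuclideanSpace ℝ (Fin 3), dist z (y j) ≤ R₇ → ∃ k : Fin N, dist z (y k) ≤ 1) ∧ (∀ j' : Fin N, dist (y j') (y j) ≤ R₇ → (let d : ℝ := sInf ((fun z => dist z (y j')) '' (Set.range (y) \ {(y j')})); ∀ k : Fin N, y k ≠ y j' → dist (y k) (y j') < 27 / 20 * d → 5 ≤ Nat.card {m : Fin N // y m ≠ y j' ∧ dist (y m) (y j') < 27 / 20 * d ∧ y m ≠ y k ∧ dist (y m) (y k) < 27 / 20 * d})))) ∧ (∀ j : Fin N, dist (y j) (y i) ≤ R → ∃ k : Fin N, dist (y k) (y j) ≤ R₈ ∧ Gy (1 / 8) N (y) k) ∧ (∀ j : Fin N, dist (y j) (y i) ≤ R → ¬ ((∀ j' : Fin N, dist (y j') (y j) ≤ R₉ → ¬ Gy (1 / 20) N (y) j') ∧ (Nat.card {j' : Fin N // dist (y j') (y j) ≤ R₉ ∧ ¬ Gy (1 / 8) N (y) j'} : ℝ) ≤ 1 / 2 * (Nat.card {j' : Fin N // dist (y j') (y j) ≤ R₉}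 : ℝ) ∧ (∀ j' : Fin N, dist (y j') (y j) ≤ R₉ → ¬ Gy (1 / 8) N (y) j' → ¬ (let d : ℝ := sInf ((fun z => dist z (y j')) '' (Set.range (y) \ {(y j')})); ∀ k : Fin N, y k ≠ y j' → dist (y k) (y j') < 27 / 20 * d → 5 ≤ Nat.card {m : Fin N // y m ≠ y j' ∧ dist (y m) (y j') < 27 / 20 * d ∧ y m ≠ y k ∧ dist (y m) (y k) < 27 / 20 * d})))); let Appr : MeasureTheory.Measure (EuclideanSpace ℝ (Fin 3)) → ℝ → ℝ → ℝ → Prop := fun μ R₇ R₈ R₉ => ∀ q : EuclideanSpace ℝ (Fin 3), μ {q} ≠ 0 → ∀ R ε : ℝ, 0 < ε → ∃ (N : ℕ) (y : Fin N → EuclideanSpace ℝ (Fin 3)) (i : Fin N), TexBall N y i R R₇ R₈ R₉ ∧ (∀ p : EuclideanSpace ℝ (Fin 3), μ {p} ≠ 0 → dist p q ≤ R → ∃ k : Fin N, dist (y k - y i) (p - q) ≤ ε) ∧ (∀ k : Fin N, dist (y k) (y i) ≤ R → ∃ p : EuclideanSpace ℝ (Fin 3), μ {p} ≠ 0 ∧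 dist (y k - y i) (p - q) ≤ ε); ∃ r : ℝ, 0 < r ∧ (∀ μ : MeasureTheory.Measure (EuclideanSpace ℝ (Fin 3)), Literature.Probability.Process.IsRootedHardCore δ μ → Literature.Probability.Process.IsRootedHardCore (7 / 10) μ → Appr μ R₇ R₈ R₉ → (∀ p : EuclideanSpace ℝ (Fin 3), μ {p} ≠ 0 → ∀ y : EuclideanSpace ℝ (Fin 3), (∀ q : EuclideanSpace ℝ (Fin 3), μ {q} ≠ 0 → q ≠ p → y ≠ q) → ∑' q : {q : EuclideanSpace ℝ (Fin 3) // μ {q} ≠ 0 ∧ q ≠ p}, Literature.MathematicalPhysics.StatisticalMechanics.lennardJones (dist p (q : EuclideanSpace ℝ (Fin 3))) ≤ ∑' q : {q : EuclideanSpace ℝ (Fin 3) // μ {q} ≠ 0 ∧ q ≠ p}, Literature.MathematicalPhysics.StatisticalMechanics.lennardJones (dist y (q : EuclideanSpace ℝ (Fin 3)))) → (∀ p : EuclideanSpace ℝ (Fin 3), μ {p} ≠ 0 → HasSum (fun q : {q : EuclideanSpace ℝ (Fin 3) // μ {q} ≠ 0 ∧ q ≠ p} => ((dist p (q : EuclideanSpace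 ℝ (Fin 3)))⁻¹ ^ 8 - (dist p (q : EuclideanSpace ℝ (Fin 3)))⁻¹ ^ 14) • (p - (q : EuclideanSpace ℝ (Fin 3)))) 0 ∧ (∃ L : ℝ, 0 ≤ L ∧ HasSum (fun q : {q : EuclideanSpace ℝ (Fin 3) // μ {q} ≠ 0 ∧ q ≠ p} => 11 * (dist p (q : EuclideanSpace ℝ (Fin 3)))⁻¹ ^ 14 - 5 * (dist p (q : EuclideanSpace ℝ (Fin 3)))⁻¹ ^ 8) L) ∧ ((∃ q : EuclideanSpace ℝ (Fin 3), μ {q} ≠ 0 ∧ q ≠ p) → ∃ q : EuclideanSpace ℝ (Fin 3), μ {q} ≠ 0 ∧ q ≠ p ∧ dist p q ^ 6 ≤ 11 / 5)) → {p : EuclideanSpace ℝ (Fin 3) | μ {p} ≠ 0}.Infinite → 0 < (∫ y in Metric.closedBall (0 : EuclideanSpace ℝ (Fin 3)) r, (Literature.MathematicalPhysics.StatisticalMechanics.rootEnergy Literature.MathematicalPhysics.StatisticalMechanics.lennardJones (MeasureTheory.Measure.map (fun z : EuclideanSpace ℝ (Fin 3) => z - y) μ) - (⨅ Q : Literature.MathematicalPhysics.StatisticalMechanics.PeriodicConfiguration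 3, Q.energyPerParticle Literature.MathematicalPhysics.StatisticalMechanics.lennardJones)) / ((MeasureTheory.Measure.map (fun z : EuclideanSpace ℝ (Fin 3) => z - y) μ) (Metric.closedBall (0 : EuclideanSpace ℝ (Fin 3)) r)).toReal ∂μ)) := by
  intro δ hδ R₇ R₈ R₉
  have h' := h δ hδ R₇ R₈ R₉
  dsimp only at h' ⊢
  obtain ⟨r, hr, Rc, hRc, hprice⟩ := h'
  refine ⟨r, hr, fun μ hμδ hμ7 hd he hE hinf => ?_⟩
  have hp := hprice μ hμδ hμ7 hd he hE hinf
  by_cases hI : Integrable (fun y : E3 => ((∫ z in closedBall (0 : E3) Rc, lennardJones ‖z‖ ∂(μ.map fun z : E3 => z - y)) / 2 -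
      ((7 / 10 : ℝ)⁻¹ ^ 6 / 12 + 1 / 6) * (250 * (7 / 10 : ℝ)⁻¹ ^ 3 * Rc⁻¹ ^ 3) / 2 -
      (⨅ Q : PeriodicConfiguration 3, Q.energyPerParticle lennardJones)) /
      ((μ.map fun z : E3 => z - y) (closedBall (0 : E3) r)).toReal) (μ.restrict (closedBall (0 : E3) r))
  · exact hp.trans_le (truncatedSurplus_le_surplus hμ7 hr hRc _ hI)
  · rw [integral_undef hI] at hp
    exact absurd hp (lt_irrefl 0)


/-- **THE PERIODICITY-FREE GAP from the real surplus price**: clauses (a)(b)(d)(e) alone give `e⋆ < E_P[rootEnergy]`. [folklore] -/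
theorem frustratedLawGap_of_realSurplusPrice₀
    (h : ∀ δ : ℝ, 0 < δ → ∀ R₇ R₈ R₉ : ℝ, let Gy : ℝ → (N : ℕ) → (Fin N → EuclideanSpace ℝ (Fin 3)) → Fin N → Prop := fun η N y j => let d : ℝ := sInf ((fun z => dist z (y (j : Fin N))) '' (Set.range (y) \ {(y (j : Fin N))})); let T : Set (EuclideanSpace ℝ (Fin 3)) := {z : EuclideanSpace ℝ (Fin 3) | z ∈ Set.range (y) ∧ z ≠ (y (j : Fin N)) ∧ dist z (y (j : Fin N)) < 13 / 10 * d}; ∃ A : EuclideanSpace ℝ (Fin 3) →ₗᵢ[ℝ] EuclideanSpace ℝ (Fin 3), (∃ e : ↥T ≃ ↥Literature.Geometry.DiscreteGeometry.fccKissingPattern, ∀ t : ↥T, dist (d⁻¹ • ((t : EuclideanSpace ℝ (Fin 3)) - (y (j : Fin N)))) (A ((e t : ↥Literature.Geometry.DiscreteGeometry.fccKissingPattern) : EuclideanSpace ℝ (Fin 3))) ≤ η) ∨ (∃ e : ↥T ≃ ↥Literature.Geometry.DiscreteGeometry.hcpKissingPattern, ∀ t : ↥T, dist (d⁻¹ •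 ((t : EuclideanSpace ℝ (Fin 3)) - (y (j : Fin N)))) (A ((e t : ↥Literature.Geometry.DiscreteGeometry.hcpKissingPattern) : EuclideanSpace ℝ (Fin 3))) ≤ η); let TexBall : (N : ℕ) → (Fin N → EuclideanSpace ℝ (Fin 3)) → Fin N → ℝ → ℝ → ℝ → ℝ → Prop := fun N y i R R₇ R₈ R₉ => (∀ a b : Fin N, a ≠ b → (7 : ℝ) / 10 ≤ dist (y a) (y b)) ∧ (∀ j : Fin N, dist (y j) (y i) ≤ R → ¬ Gy (1 / 20) N (y) j) ∧ (∀ j : Fin N, dist (y j) (y i) ≤ R → ¬ ((∀ j' : Fin N, dist (y j') (y j) ≤ R₇ → ¬ Gy (1 / 20) N (y) j') ∧ (∀ z : EuclideanSpace ℝ (Fin 3), dist z (y j) ≤ R₇ → ∃ k : Fin N, dist z (y k) ≤ 1) ∧ (∀ j' : Fin N, dist (y j') (y j) ≤ R₇ → (let d : ℝ := sInf ((fun z => dist z (y j')) '' (Set.range (y) \ {(y j')})); ∀ k : Fin N, y k ≠ y j' → dist (y k) (y j') < 27 / 20 * d → 5 ≤ Nat.card {m : Fin N // y m ≠ y j'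 ∧ dist (y m) (y j') < 27 / 20 * d ∧ y m ≠ y k ∧ dist (y m) (y k) < 27 / 20 * d})))) ∧ (∀ j : Fin N, dist (y j) (y i) ≤ R → ∃ k : Fin N, dist (y k) (y j) ≤ R₈ ∧ Gy (1 / 8) N (y) k) ∧ (∀ j : Fin N, dist (y j) (y i) ≤ R → ¬ ((∀ j' : Fin N, dist (y j') (y j) ≤ R₉ → ¬ Gy (1 / 20) N (y) j') ∧ (Nat.card {j' : Fin N // dist (y j') (y j) ≤ R₉ ∧ ¬ Gy (1 / 8) N (y) j'} : ℝ) ≤ 1 / 2 * (Nat.card {j' : Fin N // dist (y j') (y j) ≤ R₉} : ℝ) ∧ (∀ j' : Fin N, dist (y j') (y j) ≤ R₉ → ¬ Gy (1 / 8) N (y) j' → ¬ (let d : ℝ := sInf ((fun z => dist z (y j')) '' (Set.range (y) \ {(y j')})); ∀ k : Fin N, y k ≠ y j' → dist (y k) (y j') < 27 / 20 * d → 5 ≤ Nat.card {m : Fin N // y m ≠ y j' ∧ dist (y m) (y j') < 27 / 20 * d ∧ y m ≠ y k ∧ dist (y m) (y k) < 27 / 20 * d})))); let Appr : MeasureTheory.Measure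 (EuclideanSpace ℝ (Fin 3)) → ℝ → ℝ → ℝ → Prop := fun μ R₇ R₈ R₉ => ∀ q : EuclideanSpace ℝ (Fin 3), μ {q} ≠ 0 → ∀ R ε : ℝ, 0 < ε → ∃ (N : ℕ) (y : Fin N → EuclideanSpace ℝ (Fin 3)) (i : Fin N), TexBall N y i R R₇ R₈ R₉ ∧ (∀ p : EuclideanSpace ℝ (Fin 3), μ {p} ≠ 0 → dist p q ≤ R → ∃ k : Fin N, dist (y k - y i) (p - q) ≤ ε) ∧ (∀ k : Fin N, dist (y k) (y i) ≤ R → ∃ p : EuclideanSpace ℝ (Fin 3), μ {p} ≠ 0 ∧ dist (y k - y i) (p - q) ≤ ε); ∃ r : ℝ, 0 < r ∧ (∀ μ : MeasureTheory.Measure (EuclideanSpace ℝ (Fin 3)), Literature.Probability.Process.IsRootedHardCore δ μ → Literature.Probability.Process.IsRootedHardCore (7 / 10) μ → Appr μ R₇ R₈ R₉ → (∀ p : EuclideanSpace ℝ (Fin 3), μ {p} ≠ 0 → ∀ y : EuclideanSpace ℝ (Fin 3), (∀ q : EuclideanSpace ℝ (Fin 3), μ {q} ≠ 0 → q ≠ p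 → y ≠ q) → ∑' q : {q : EuclideanSpace ℝ (Fin 3) // μ {q} ≠ 0 ∧ q ≠ p}, Literature.MathematicalPhysics.StatisticalMechanics.lennardJones (dist p (q : EuclideanSpace ℝ (Fin 3))) ≤ ∑' q : {q : EuclideanSpace ℝ (Fin 3) // μ {q} ≠ 0 ∧ q ≠ p}, Literature.MathematicalPhysics.StatisticalMechanics.lennardJones (dist y (q : EuclideanSpace ℝ (Fin 3)))) → (∀ p : EuclideanSpace ℝ (Fin 3), μ {p} ≠ 0 → HasSum (fun q : {q : EuclideanSpace ℝ (Fin 3) // μ {q} ≠ 0 ∧ q ≠ p} => ((dist p (q : EuclideanSpace ℝ (Fin 3)))⁻¹ ^ 8 - (dist p (q : EuclideanSpace ℝ (Fin 3)))⁻¹ ^ 14) • (p - (q : EuclideanSpace ℝ (Fin 3)))) 0 ∧ (∃ L : ℝ, 0 ≤ L ∧ HasSum (fun q : {q : EuclideanSpace ℝ (Fin 3) // μ {q} ≠ 0 ∧ q ≠ p} => 11 * (dist p (q : EuclideanSpace ℝ (Fin 3)))⁻¹ ^ 14 - 5 * (dist p (q : EuclideanSpace ℝ (Fin 3)))⁻¹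 ^ 8) L) ∧ ((∃ q : EuclideanSpace ℝ (Fin 3), μ {q} ≠ 0 ∧ q ≠ p) → ∃ q : EuclideanSpace ℝ (Fin 3), μ {q} ≠ 0 ∧ q ≠ p ∧ dist p q ^ 6 ≤ 11 / 5)) → {p : EuclideanSpace ℝ (Fin 3) | μ {p} ≠ 0}.Infinite → 0 < (∫ y in Metric.closedBall (0 : EuclideanSpace ℝ (Fin 3)) r, (Literature.MathematicalPhysics.StatisticalMechanics.rootEnergy Literature.MathematicalPhysics.StatisticalMechanics.lennardJones (MeasureTheory.Measure.map (fun z : EuclideanSpace ℝ (Fin 3) => z - y) μ) - (⨅ Q : Literature.MathematicalPhysics.StatisticalMechanics.PeriodicConfiguration 3, Q.energyPerParticle Literature.MathematicalPhysics.StatisticalMechanics.lennardJones)) / ((MeasureTheory.Measure.map (fun z : EuclideanSpace ℝ (Fin 3) => z - y) μ) (Metric.closedBall (0 : EuclideanSpace ℝ (Fin 3)) r)).toReal ∂μ))) :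
    ∀ δ : ℝ, 0 < δ → ∀ P : MeasureTheory.Measure (MeasureTheory.Measure (EuclideanSpace ℝ (Fin 3))), let Gy : ℝ → (N : ℕ) → (Fin N → EuclideanSpace ℝ (Fin 3)) → Fin N → Prop := fun η N y j => let d : ℝ := sInf ((fun z => dist z (y (j : Fin N))) '' (Set.range (y) \ {(y (j : Fin N))})); let T : Set (EuclideanSpace ℝ (Fin 3)) := {z : EuclideanSpace ℝ (Fin 3) | z ∈ Set.range (y) ∧ z ≠ (y (j : Fin N)) ∧ dist z (y (j : Fin N)) < 13 / 10 * d}; ∃ A : EuclideanSpace ℝ (Fin 3) →ₗᵢ[ℝ] EuclideanSpace ℝ (Fin 3), (∃ e : ↥T ≃ ↥Literature.Geometry.DiscreteGeometry.fccKissingPattern, ∀ t : ↥T, dist (d⁻¹ • ((t : EuclideanSpace ℝ (Fin 3)) - (y (j : Fin N)))) (A ((e t : ↥Literature.Geometry.DiscreteGeometry.fccKissingPattern) : EuclideanSpace ℝ (Fin 3))) ≤ η) ∨ (∃ e : ↥T ≃ ↥Literature.Geometry.DiscreteGeometry.hcpKissingPattern, ∀ t : ↥T, dist (d⁻¹ •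 ((t : EuclideanSpace ℝ (Fin 3)) - (y (j : Fin N)))) (A ((e t : ↥Literature.Geometry.DiscreteGeometry.hcpKissingPattern) : EuclideanSpace ℝ (Fin 3))) ≤ η); let TexBall : (N : ℕ) → (Fin N → EuclideanSpace ℝ (Fin 3)) → Fin N → ℝ → ℝ → ℝ → ℝ → Prop := fun N y i R R₇ R₈ R₉ => (∀ a b : Fin N, a ≠ b → (7 : ℝ) / 10 ≤ dist (y a) (y b)) ∧ (∀ j : Fin N, dist (y j) (y i) ≤ R → ¬ Gy (1 / 20) N (y) j) ∧ (∀ j : Fin N, dist (y j) (y i) ≤ R → ¬ ((∀ j' : Fin N, dist (y j') (y j) ≤ R₇ → ¬ Gy (1 / 20) N (y) j') ∧ (∀ z : EuclideanSpace ℝ (Fin 3), dist z (y j) ≤ R₇ → ∃ k : Fin N, dist z (y k) ≤ 1) ∧ (∀ j' : Fin N, dist (y j') (y j) ≤ R₇ → (let d : ℝ := sInf ((fun z => dist z (y j')) '' (Set.range (y) \ {(y j')})); ∀ k : Fin N, y k ≠ y j' → dist (y k) (y j') < 27 / 20 * d → 5 ≤ Nat.card {m : Fin N // y m ≠ y j'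 ∧ dist (y m) (y j') < 27 / 20 * d ∧ y m ≠ y k ∧ dist (y m) (y k) < 27 / 20 * d})))) ∧ (∀ j : Fin N, dist (y j) (y i) ≤ R → ∃ k : Fin N, dist (y k) (y j) ≤ R₈ ∧ Gy (1 / 8) N (y) k) ∧ (∀ j : Fin N, dist (y j) (y i) ≤ R → ¬ ((∀ j' : Fin N, dist (y j') (y j) ≤ R₉ → ¬ Gy (1 / 20) N (y) j') ∧ (Nat.card {j' : Fin N // dist (y j') (y j) ≤ R₉ ∧ ¬ Gy (1 / 8) N (y) j'} : ℝ) ≤ 1 / 2 * (Nat.card {j' : Fin N // dist (y j') (y j) ≤ R₉} : ℝ) ∧ (∀ j' : Fin N, dist (y j') (y j) ≤ R₉ → ¬ Gy (1 / 8) N (y) j' → ¬ (let d : ℝ := sInf ((fun z => dist z (y j')) '' (Set.range (y) \ {(y j')})); ∀ k : Fin N, y k ≠ y j' → dist (y k) (y j') < 27 / 20 * d → 5 ≤ Nat.card {m : Fin N // y m ≠ y j' ∧ dist (y m) (y j') < 27 / 20 * d ∧ y m ≠ y k ∧ dist (y m) (y k) < 27 / 20 * d})))); let Appr : MeasureTheory.Measure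 (EuclideanSpace ℝ (Fin 3)) → ℝ → ℝ → ℝ → Prop := fun μ R₇ R₈ R₉ => ∀ q : EuclideanSpace ℝ (Fin 3), μ {q} ≠ 0 → ∀ R ε : ℝ, 0 < ε → ∃ (N : ℕ) (y : Fin N → EuclideanSpace ℝ (Fin 3)) (i : Fin N), TexBall N y i R R₇ R₈ R₉ ∧ (∀ p : EuclideanSpace ℝ (Fin 3), μ {p} ≠ 0 → dist p q ≤ R → ∃ k : Fin N, dist (y k - y i) (p - q) ≤ ε) ∧ (∀ k : Fin N, dist (y k) (y i) ≤ R → ∃ p : EuclideanSpace ℝ (Fin 3), μ {p} ≠ 0 ∧ dist (y k - y i) (p - q) ≤ ε); MeasureTheory.IsProbabilityMeasure P → (∀ᵐ μ ∂P, Literature.Probability.Process.IsRootedHardCore δ μ) → Literature.Probability.Process.IsPointStationaryLaw P → (∃ R₇ R₈ R₉ : ℝ, ∀ᵐ μ ∂P, Appr μ R₇ R₈ R₉) → (∀ᵐ μ ∂P, ∀ p : EuclideanSpace ℝ (Fin 3), μ {p} ≠ 0 → ∀ y : EuclideanSpace ℝ (Fin 3), (∀ q : EuclideanSpace ℝ (Fin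 3), μ {q} ≠ 0 → q ≠ p → y ≠ q) → ∑' q : {q : EuclideanSpace ℝ (Fin 3) // μ {q} ≠ 0 ∧ q ≠ p}, Literature.MathematicalPhysics.StatisticalMechanics.lennardJones (dist p (q : EuclideanSpace ℝ (Fin 3))) ≤ ∑' q : {q : EuclideanSpace ℝ (Fin 3) // μ {q} ≠ 0 ∧ q ≠ p}, Literature.MathematicalPhysics.StatisticalMechanics.lennardJones (dist y (q : EuclideanSpace ℝ (Fin 3)))) → (⨅ Q : Literature.MathematicalPhysics.StatisticalMechanics.PeriodicConfiguration 3, Q.energyPerParticle Literature.MathematicalPhysics.StatisticalMechanics.lennardJones) < (∫ μ, Literature.MathematicalPhysics.StatisticalMechanics.rootEnergy Literature.MathematicalPhysics.StatisticalMechanics.lennardJones μ ∂P) := by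
  intro δ hδ P
  have h' := h δ hδ
  dsimp only at h' ⊢
  intro hP ha hb hd he
  obtain ⟨R₇, R₈, R₉, hd'⟩ := hd
  obtain ⟨r, hr, hprice⟩ := h' R₇ R₈ R₉
  by_contra hlt
  have hmin := not_lt.mp hlt
  have h7 : ∀ᵐ μ ∂P, Literature.Probability.Process.IsRootedHardCore (7 / 10) μ := by
    refine ae_isRootedHardCore_upgrade ha (hd'.mono fun μ hμ q hq R ε hε => ?_)
    obtain ⟨N, y, i, ⟨h1, -, -, -, -⟩, hm1, -⟩ := hμ q hq R ε hε
    exact ⟨N, y, i, h1, hm1⟩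
  have hEQ : ∀ᵐ μ ∂P, (∀ p : EuclideanSpace ℝ (Fin 3), μ {p} ≠ 0 → HasSum (fun q : {q : EuclideanSpace ℝ (Fin 3) // μ {q} ≠ 0 ∧ q ≠ p} => ((dist p (q : EuclideanSpace ℝ (Fin 3)))⁻¹ ^ 8 - (dist p (q : EuclideanSpace ℝ (Fin 3)))⁻¹ ^ 14) • (p - (q : EuclideanSpace ℝ (Fin 3)))) 0 ∧ (∃ L : ℝ, 0 ≤ L ∧ HasSum (fun q : {q : EuclideanSpace ℝ (Fin 3) // μ {q} ≠ 0 ∧ q ≠ p} => 11 * (dist p (q : EuclideanSpace ℝ (Fin 3)))⁻¹ ^ 14 - 5 * (dist p (q : EuclideanSpace ℝ (Fin 3)))⁻¹ ^ 8) L) ∧ ((∃ q : EuclideanSpace ℝ (Fin 3), μ {q} ≠ 0 ∧ q ≠ p) → ∃ q : EuclideanSpace ℝ (Fin 3), μ {q} ≠ 0 ∧ q ≠ p ∧ dist p q ^ 6 ≤ 11 / 5)) := by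
    filter_upwards [ae_forceBalance_of_nash (by norm_num : (0 : ℝ) < 7 / 10) h7 he,
      ae_laplacian_nonneg_of_nash (by norm_num : (0 : ℝ) < 7 / 10) h7 he,
      ae_exists_near_of_nash (by norm_num : (0 : ℝ) < 7 / 10) h7 he] with μ h₀ h₁ h₂ p hp using ⟨h₀ p hp, h₁ p hp, h₂ p hp⟩
  have hinf : ∀ᵐ μ ∂P, {p : EuclideanSpace ℝ (Fin 3) | μ {p} ≠ 0}.Infinite :=
    ae_infinite_of_minimising_of_decl Summit.AtomisticToContinuum.Crystallization.Theorems.unimodularEnergyLowerBound_proof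
      hδ ha hb hmin
  refine hlt (eStar_lt_integral_rootEnergy_of_ae_surplusSharing h7 hb hr ?_)
  filter_upwards [ha, h7, hd', he, hEQ, hinf] with μ haμ h7μ hdμ heμ hEμ hiμ
  have hp := hprice μ haμ h7μ hdμ heμ hEμ hiμ
  have heq := (surplus_toReal_sub_eq_integral h7μ hr
    (⨅ Q : PeriodicConfiguration 3, Q.energyPerParticle lennardJones)).2
  linarith


/-- **R5 ⟹ the periodicity-free frustrated-law gap.** [folklore] -/
theorem frustratedLawGap_of_forceFiniteClusterPrice
    (h : ∀ δ : ℝ, 0 < δ → ∀ R₇ R₈ R₉ : ℝ, let Gy : ℝ → (N : ℕ) → (Fin N → EuclideanSpace ℝ (Fin 3)) → Fin N → Prop := fun η N y j => let d : ℝ := sInf ((fun z => dist z (y (j : Fin N))) '' (Set.range (y) \ {(y (j : Fin N))})); let T : Set (EuclideanSpace ℝ (Fin 3)) := {z : EuclideanSpace ℝ (Fin 3) | z ∈ Set.range (y) ∧ z ≠ (y (j : Fin N)) ∧ dist z (y (j : Fin N)) < 13 / 10 * d}; ∃ A : EuclideanSpace ℝ (Fin 3) →ₗᵢ[ℝ]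 EuclideanSpace ℝ (Fin 3), (∃ e : ↥T ≃ ↥Literature.Geometry.DiscreteGeometry.fccKissingPattern, ∀ t : ↥T, dist (d⁻¹ • ((t : EuclideanSpace ℝ (Fin 3)) - (y (j : Fin N)))) (A ((e t : ↥Literature.Geometry.DiscreteGeometry.fccKissingPattern) : EuclideanSpace ℝ (Fin 3))) ≤ η) ∨ (∃ e : ↥T ≃ ↥Literature.Geometry.DiscreteGeometry.hcpKissingPattern, ∀ t : ↥T, dist (d⁻¹ • ((t : EuclideanSpace ℝ (Fin 3)) - (y (j : Fin N)))) (A ((e t : ↥Literature.Geometry.DiscreteGeometry.hcpKissingPattern) : EuclideanSpace ℝ (Fin 3))) ≤ η); let TexBall : (N : ℕ) → (Fin N → EuclideanSpace ℝ (Fin 3)) → Fin N → ℝ → ℝ → ℝ → ℝ → Prop := fun N y i R R₇ R₈ R₉ => (∀ a b : Fin N, a ≠ b → (7 : ℝ) / 10 ≤ dist (y a) (y b)) ∧ (∀ j : Fin N, dist (y j) (y i) ≤ R → ¬ Gy (1 / 20) N (y) j) ∧ (∀ j : Fin N, dist (y j) (y i) ≤ R → ¬ ((∀ j' : Fin N,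 dist (y j') (y j) ≤ R₇ → ¬ Gy (1 / 20) N (y) j') ∧ (∀ z : EuclideanSpace ℝ (Fin 3), dist z (y j) ≤ R₇ → ∃ k : Fin N, dist z (y k) ≤ 1) ∧ (∀ j' : Fin N, dist (y j') (y j) ≤ R₇ → (let d : ℝ := sInf ((fun z => dist z (y j')) '' (Set.range (y) \ {(y j')})); ∀ k : Fin N, y k ≠ y j' → dist (y k) (y j') < 27 / 20 * d → 5 ≤ Nat.card {m : Fin N // y m ≠ y j' ∧ dist (y m) (y j') < 27 / 20 * d ∧ y m ≠ y k ∧ dist (y m) (y k) < 27 / 20 * d})))) ∧ (∀ j : Fin N, dist (y j) (y i) ≤ R → ∃ k : Fin N, dist (y k) (y j) ≤ R₈ ∧ Gy (1 / 8) N (y) k) ∧ (∀ j : Fin N, dist (y j) (y i) ≤ R → ¬ ((∀ j' : Fin N, dist (y j') (y j) ≤ R₉ → ¬ Gy (1 / 20) N (y) j') ∧ (Nat.card {j' : Fin N // dist (y j') (y j) ≤ R₉ ∧ ¬ Gy (1 / 8) N (y) j'} : ℝ) ≤ 1 / 2 * (Nat.card {j' : Fin N // dist (y j') (y j) ≤ R₉}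 : ℝ) ∧ (∀ j' : Fin N, dist (y j') (y j) ≤ R₉ → ¬ Gy (1 / 8) N (y) j' → ¬ (let d : ℝ := sInf ((fun z => dist z (y j')) '' (Set.range (y) \ {(y j')})); ∀ k : Fin N, y k ≠ y j' → dist (y k) (y j') < 27 / 20 * d → 5 ≤ Nat.card {m : Fin N // y m ≠ y j' ∧ dist (y m) (y j') < 27 / 20 * d ∧ y m ≠ y k ∧ dist (y m) (y k) < 27 / 20 * d})))); ∃ r : ℝ, 0 < r ∧ ∃ Rc : ℝ, 6 / 5 ≤ Rc ∧ ∀ ω : Finset (EuclideanSpace ℝ (Fin 3)), (0 : EuclideanSpace ℝ (Fin 3)) ∈ ω → (∀ p ∈ ω, ‖p‖ ≤ 2 * r + Rc + 1) → (∀ a ∈ ω, ∀ b ∈ ω, a ≠ b → δ ≤ dist a b) → (∀ a ∈ ω, ∀ b ∈ ω, a ≠ b → (7 : ℝ) / 10 ≤ dist a b) → (∀ q ∈ ω, ‖q‖ ≤ r → ∀ ε : ℝ, 0 < ε → ε ≤ 1 → ∃ (N : ℕ) (y : Fin N → EuclideanSpace ℝ (Fin 3)) (i : Fin N), TexBall N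 y i (r + Rc) R₇ R₈ R₉ ∧ (∀ p ∈ ω, dist p q ≤ r + Rc → ∃ k : Fin N, dist (y k - y i) (p - q) ≤ ε) ∧ (∀ k : Fin N, dist (y k) (y i) ≤ r + Rc → ∃ p ∈ ω, dist (y k - y i) (p - q) ≤ ε)) → (∀ p ∈ ω, ‖p‖ ≤ r → ∃ q ∈ ω, q ≠ p ∧ dist p q ^ 6 ≤ 11 / 5) → (∀ p ∈ ω, ‖p‖ ≤ r → 0 ≤ ∑ q ∈ ω.filter (fun q : EuclideanSpace ℝ (Fin 3) => q ≠ p ∧ ‖q - p‖ ≤ Rc), (11 * (dist p q)⁻¹ ^ 14 - 5 * (dist p q)⁻¹ ^ 8)) → (∀ p ∈ ω, ‖p‖ ≤ r → ‖∑ q ∈ ω.filter (fun q : EuclideanSpace ℝ (Fin 3) => q ≠ p ∧ ‖q - p‖ ≤ Rc), (((dist p q)⁻¹ ^ 8 - (dist p q)⁻¹ ^ 14) • (p - q))‖ ≤ (Rc⁻¹ ^ 7 + Rc⁻¹) * (250 * (7 / 10 : ℝ)⁻¹ ^ 3 * Rc⁻¹ ^ 3)) → 0 < (∑ y ∈ ω.filter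 (fun y : EuclideanSpace ℝ (Fin 3) => ‖y‖ ≤ r), ((∑ q ∈ ω.filter (fun q : EuclideanSpace ℝ (Fin 3) => ‖q - y‖ ≤ Rc), Literature.MathematicalPhysics.StatisticalMechanics.lennardJones ‖q - y‖) / 2 - ((7 / 10 : ℝ)⁻¹ ^ 6 / 12 + 1 / 6) * (250 * (7 / 10 : ℝ)⁻¹ ^ 3 * Rc⁻¹ ^ 3) / 2 - (⨅ Q : Literature.MathematicalPhysics.StatisticalMechanics.PeriodicConfiguration 3, Q.energyPerParticle Literature.MathematicalPhysics.StatisticalMechanics.lennardJones)) / ((ω.filter (fun q : EuclideanSpace ℝ (Fin 3) => ‖q - y‖ ≤ r)).card : ℝ))) :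
    ∀ δ : ℝ, 0 < δ → ∀ P : MeasureTheory.Measure (MeasureTheory.Measure (EuclideanSpace ℝ (Fin 3))), let Gy : ℝ → (N : ℕ) → (Fin N → EuclideanSpace ℝ (Fin 3)) → Fin N → Prop := fun η N y j => let d : ℝ := sInf ((fun z => dist z (y (j : Fin N))) '' (Set.range (y) \ {(y (j : Fin N))})); let T : Set (EuclideanSpace ℝ (Fin 3)) := {z : EuclideanSpace ℝ (Fin 3) | z ∈ Set.range (y) ∧ z ≠ (y (j : Fin N)) ∧ dist z (y (j : Fin N)) < 13 / 10 * d}; ∃ A : EuclideanSpace ℝ (Fin 3) →ₗᵢ[ℝ] EuclideanSpace ℝ (Fin 3), (∃ e : ↥T ≃ ↥Literature.Geometry.DiscreteGeometry.fccKissingPattern, ∀ t : ↥T, dist (d⁻¹ • ((t : EuclideanSpace ℝ (Fin 3)) - (y (j : Fin N)))) (A ((e t : ↥Literature.Geometry.DiscreteGeometry.fccKissingPattern) : EuclideanSpace ℝ (Fin 3))) ≤ η) ∨ (∃ e : ↥T ≃ ↥Literature.Geometry.DiscreteGeometry.hcpKissingPattern, ∀ t : ↥T, dist (d⁻¹ •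 ((t : EuclideanSpace ℝ (Fin 3)) - (y (j : Fin N)))) (A ((e t : ↥Literature.Geometry.DiscreteGeometry.hcpKissingPattern) : EuclideanSpace ℝ (Fin 3))) ≤ η); let TexBall : (N : ℕ) → (Fin N → EuclideanSpace ℝ (Fin 3)) → Fin N → ℝ → ℝ → ℝ → ℝ → Prop := fun N y i R R₇ R₈ R₉ => (∀ a b : Fin N, a ≠ b → (7 : ℝ) / 10 ≤ dist (y a) (y b)) ∧ (∀ j : Fin N, dist (y j) (y i) ≤ R → ¬ Gy (1 / 20) N (y) j) ∧ (∀ j : Fin N, dist (y j) (y i) ≤ R → ¬ ((∀ j' : Fin N, dist (y j') (y j) ≤ R₇ → ¬ Gy (1 / 20) N (y) j') ∧ (∀ z : EuclideanSpace ℝ (Fin 3), dist z (y j) ≤ R₇ → ∃ k : Fin N, dist z (y k) ≤ 1) ∧ (∀ j' : Fin N, dist (y j') (y j) ≤ R₇ → (let d : ℝ := sInf ((fun z => dist z (y j')) '' (Set.range (y) \ {(y j')})); ∀ k : Fin N, y k ≠ y j' → dist (y k) (y j') < 27 / 20 * d → 5 ≤ Nat.card {m : Fin N // y m ≠ y j'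 ∧ dist (y m) (y j') < 27 / 20 * d ∧ y m ≠ y k ∧ dist (y m) (y k) < 27 / 20 * d})))) ∧ (∀ j : Fin N, dist (y j) (y i) ≤ R → ∃ k : Fin N, dist (y k) (y j) ≤ R₈ ∧ Gy (1 / 8) N (y) k) ∧ (∀ j : Fin N, dist (y j) (y i) ≤ R → ¬ ((∀ j' : Fin N, dist (y j') (y j) ≤ R₉ → ¬ Gy (1 / 20) N (y) j') ∧ (Nat.card {j' : Fin N // dist (y j') (y j) ≤ R₉ ∧ ¬ Gy (1 / 8) N (y) j'} : ℝ) ≤ 1 / 2 * (Nat.card {j' : Fin N // dist (y j') (y j) ≤ R₉} : ℝ) ∧ (∀ j' : Fin N, dist (y j') (y j) ≤ R₉ → ¬ Gy (1 / 8) N (y) j' → ¬ (let d : ℝ := sInf ((fun z => dist z (y j')) '' (Set.range (y) \ {(y j')})); ∀ k : Fin N, y k ≠ y j' → dist (y k) (y j') < 27 / 20 * d → 5 ≤ Nat.card {m : Fin N // y m ≠ y j' ∧ dist (y m) (y j') < 27 / 20 * d ∧ y m ≠ y k ∧ dist (y m) (y k) < 27 / 20 * d})))); let Appr : MeasureTheory.Measure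 (EuclideanSpace ℝ (Fin 3)) → ℝ → ℝ → ℝ → Prop := fun μ R₇ R₈ R₉ => ∀ q : EuclideanSpace ℝ (Fin 3), μ {q} ≠ 0 → ∀ R ε : ℝ, 0 < ε → ∃ (N : ℕ) (y : Fin N → EuclideanSpace ℝ (Fin 3)) (i : Fin N), TexBall N y i R R₇ R₈ R₉ ∧ (∀ p : EuclideanSpace ℝ (Fin 3), μ {p} ≠ 0 → dist p q ≤ R → ∃ k : Fin N, dist (y k - y i) (p - q) ≤ ε) ∧ (∀ k : Fin N, dist (y k) (y i) ≤ R → ∃ p : EuclideanSpace ℝ (Fin 3), μ {p} ≠ 0 ∧ dist (y k - y i) (p - q) ≤ ε); MeasureTheory.IsProbabilityMeasure P → (∀ᵐ μ ∂P, Literature.Probability.Process.IsRootedHardCore δ μ) → Literature.Probability.Process.IsPointStationaryLaw P → (∃ R₇ R₈ R₉ : ℝ, ∀ᵐ μ ∂P, Appr μ R₇ R₈ R₉) → (∀ᵐ μ ∂P, ∀ p : EuclideanSpace ℝ (Fin 3), μ {p} ≠ 0 → ∀ y : EuclideanSpace ℝ (Fin 3), (∀ q : EuclideanSpace ℝ (Fin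 3), μ {q} ≠ 0 → q ≠ p → y ≠ q) → ∑' q : {q : EuclideanSpace ℝ (Fin 3) // μ {q} ≠ 0 ∧ q ≠ p}, Literature.MathematicalPhysics.StatisticalMechanics.lennardJones (dist p (q : EuclideanSpace ℝ (Fin 3))) ≤ ∑' q : {q : EuclideanSpace ℝ (Fin 3) // μ {q} ≠ 0 ∧ q ≠ p}, Literature.MathematicalPhysics.StatisticalMechanics.lennardJones (dist y (q : EuclideanSpace ℝ (Fin 3)))) → (⨅ Q : Literature.MathematicalPhysics.StatisticalMechanics.PeriodicConfiguration 3, Q.energyPerParticle Literature.MathematicalPhysics.StatisticalMechanics.lennardJones) < (∫ μ, Literature.MathematicalPhysics.StatisticalMechanics.rootEnergy Literature.MathematicalPhysics.StatisticalMechanics.lennardJones μ ∂P) :=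
  frustratedLawGap_of_realSurplusPrice₀ (realSurplusPrice₀_of_truncatedSurplusPrice₀ (truncatedSurplusPrice₀_of_forceFiniteClusterPrice h))

/-- **THE SIBLING CRUX `PeriodicFrustratedLawGap` (item 27624) from the force-loaded finite-cluster price**, BY NAME. [folklore] -/
theorem periodicFrustratedLawGap_of_forceFiniteClusterPrice
    (h : ∀ δ : ℝ, 0 < δ → ∀ R₇ R₈ R₉ : ℝ, let Gy : ℝ → (N : ℕ) → (Fin N → EuclideanSpace ℝ (Fin 3)) → Fin N → Prop := fun η N y j => let d : ℝ := sInf ((fun z => dist z (y (j : Fin N))) '' (Set.range (y) \ {(y (j : Fin N))})); let T : Set (EuclideanSpace ℝ (Fin 3)) := {z : EuclideanSpace ℝ (Fin 3) | z ∈ Set.range (y) ∧ z ≠ (y (j : Fin N)) ∧ dist z (y (j : Fin N)) < 13 / 10 * d}; ∃ A : EuclideanSpace ℝ (Fin 3) →ₗᵢ[ℝ] EuclideanSpace ℝ (Fin 3), (∃ e : ↥T ≃ ↥Literature.Geometry.DiscreteGeometry.fccKissingPattern, ∀ t : ↥T, dist (d⁻¹ • ((t : EuclideanSpace ℝ (Fin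 3)) - (y (j : Fin N)))) (A ((e t : ↥Literature.Geometry.DiscreteGeometry.fccKissingPattern) : EuclideanSpace ℝ (Fin 3))) ≤ η) ∨ (∃ e : ↥T ≃ ↥Literature.Geometry.DiscreteGeometry.hcpKissingPattern, ∀ t : ↥T, dist (d⁻¹ • ((t : EuclideanSpace ℝ (Fin 3)) - (y (j : Fin N)))) (A ((e t : ↥Literature.Geometry.DiscreteGeometry.hcpKissingPattern) : EuclideanSpace ℝ (Fin 3))) ≤ η); let TexBall : (N : ℕ) → (Fin N → EuclideanSpace ℝ (Fin 3)) → Fin N → ℝ → ℝ → ℝ → ℝ → Prop := fun N y i R R₇ R₈ R₉ => (∀ a b : Fin N, a ≠ b → (7 : ℝ) / 10 ≤ dist (y a) (y b)) ∧ (∀ j : Fin N, dist (y j) (y i) ≤ R → ¬ Gy (1 / 20) N (y) j) ∧ (∀ j : Fin N, dist (y j) (y i) ≤ R → ¬ ((∀ j' : Fin N, dist (y j') (y j) ≤ R₇ → ¬ Gy (1 / 20) N (y) j') ∧ (∀ z : EuclideanSpace ℝ (Fin 3), dist z (y j) ≤ R₇ → ∃ k : Fin N, dist z (y k) ≤ 1)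 ∧ (∀ j' : Fin N, dist (y j') (y j) ≤ R₇ → (let d : ℝ := sInf ((fun z => dist z (y j')) '' (Set.range (y) \ {(y j')})); ∀ k : Fin N, y k ≠ y j' → dist (y k) (y j') < 27 / 20 * d → 5 ≤ Nat.card {m : Fin N // y m ≠ y j' ∧ dist (y m) (y j') < 27 / 20 * d ∧ y m ≠ y k ∧ dist (y m) (y k) < 27 / 20 * d})))) ∧ (∀ j : Fin N, dist (y j) (y i) ≤ R → ∃ k : Fin N, dist (y k) (y j) ≤ R₈ ∧ Gy (1 / 8) N (y) k) ∧ (∀ j : Fin N, dist (y j) (y i) ≤ R → ¬ ((∀ j' : Fin N, dist (y j') (y j) ≤ R₉ → ¬ Gy (1 / 20) N (y) j') ∧ (Nat.card {j' : Fin N // dist (y j') (y j) ≤ R₉ ∧ ¬ Gy (1 / 8) N (y) j'} : ℝ) ≤ 1 / 2 * (Nat.card {j' : Fin N // dist (y j') (y j) ≤ R₉} : ℝ) ∧ (∀ j' : Fin N, dist (y j') (y j) ≤ R₉ → ¬ Gy (1 / 8) N (y) j' → ¬ (let d : ℝ := sInf ((fun z => dist z (y j')) '' (Set.range (y) \ {(y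 j')})); ∀ k : Fin N, y k ≠ y j' → dist (y k) (y j') < 27 / 20 * d → 5 ≤ Nat.card {m : Fin N // y m ≠ y j' ∧ dist (y m) (y j') < 27 / 20 * d ∧ y m ≠ y k ∧ dist (y m) (y k) < 27 / 20 * d})))); ∃ r : ℝ, 0 < r ∧ ∃ Rc : ℝ, 6 / 5 ≤ Rc ∧ ∀ ω : Finset (EuclideanSpace ℝ (Fin 3)), (0 : EuclideanSpace ℝ (Fin 3)) ∈ ω → (∀ p ∈ ω, ‖p‖ ≤ 2 * r + Rc + 1) → (∀ a ∈ ω, ∀ b ∈ ω, a ≠ b → δ ≤ dist a b) → (∀ a ∈ ω, ∀ b ∈ ω, a ≠ b → (7 : ℝ) / 10 ≤ dist a b) → (∀ q ∈ ω, ‖q‖ ≤ r → ∀ ε : ℝ, 0 < ε → ε ≤ 1 → ∃ (N : ℕ) (y : Fin N → EuclideanSpace ℝ (Fin 3)) (i : Fin N), TexBall N y i (r + Rc) R₇ R₈ R₉ ∧ (∀ p ∈ ω, dist p q ≤ r + Rc → ∃ k : Fin N, dist (y k - y i) (p - q) ≤ ε) ∧ (∀ k : Fin N, dist (y k) (y i)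 ≤ r + Rc → ∃ p ∈ ω, dist (y k - y i) (p - q) ≤ ε)) → (∀ p ∈ ω, ‖p‖ ≤ r → ∃ q ∈ ω, q ≠ p ∧ dist p q ^ 6 ≤ 11 / 5) → (∀ p ∈ ω, ‖p‖ ≤ r → 0 ≤ ∑ q ∈ ω.filter (fun q : EuclideanSpace ℝ (Fin 3) => q ≠ p ∧ ‖q - p‖ ≤ Rc), (11 * (dist p q)⁻¹ ^ 14 - 5 * (dist p q)⁻¹ ^ 8)) → (∀ p ∈ ω, ‖p‖ ≤ r → ‖∑ q ∈ ω.filter (fun q : EuclideanSpace ℝ (Fin 3) => q ≠ p ∧ ‖q - p‖ ≤ Rc), (((dist p q)⁻¹ ^ 8 - (dist p q)⁻¹ ^ 14) • (p - q))‖ ≤ (Rc⁻¹ ^ 7 + Rc⁻¹) * (250 * (7 / 10 : ℝ)⁻¹ ^ 3 * Rc⁻¹ ^ 3)) → 0 < (∑ y ∈ ω.filter (fun y : EuclideanSpace ℝ (Fin 3) => ‖y‖ ≤ r), ((∑ q ∈ ω.filter (fun q : EuclideanSpace ℝ (Fin 3) => ‖q - y‖ ≤ Rc), Literature.MathematicalPhysics.StatisticalMechanics.lennardJones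 ‖q - y‖) / 2 - ((7 / 10 : ℝ)⁻¹ ^ 6 / 12 + 1 / 6) * (250 * (7 / 10 : ℝ)⁻¹ ^ 3 * Rc⁻¹ ^ 3) / 2 - (⨅ Q : Literature.MathematicalPhysics.StatisticalMechanics.PeriodicConfiguration 3, Q.energyPerParticle Literature.MathematicalPhysics.StatisticalMechanics.lennardJones)) / ((ω.filter (fun q : EuclideanSpace ℝ (Fin 3) => ‖q - y‖ ≤ r)).card : ℝ))) :
    Summit.AtomisticToContinuum.Crystallization.Theses.FrustratedLawDichotomy.PeriodicFrustratedLawGap := by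
  have hg := frustratedLawGap_of_forceFiniteClusterPrice h
  intro δ hδ P
  have h' := hg δ hδ P
  dsimp only at h' ⊢
  intro hP ha hb hd he _
  exact h' hP ha hb hd he

end Summit.AtomisticToContinuum.Crystallization.Theorems.FrustratedLawDichotomyTransportPriceFrustratedGap

end
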